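import Summits.ResolutionOfSingularities.ResolutionOfSingularities.Theorems.HomologicalConductorNoZenoSurfaceLU
import Summits.ResolutionOfSingularities.ResolutionOfSingularities.Theorems.SyzygyFlatteningHigherRankTerminationEssFiniteType
import Literature.AlgebraicGeometry.Resolution.QuadraticTransforms
import Literature.AlgebraicGeometry.Resolution.QuadraticTransformsUFD
import Literature.AlgebraicGeometry.Resolution.InseparableLocalUniformization
import HarnessLib

/-!
# Crux `NoZenoR` / `NoZeno` (stmt-ResolutionOfSingularities-19943 / -16483): LOCAL UNIFORMIZATION WITH
# TWO-DIMENSIONAL CENTRE of a coarsening — the `hLU` input of the exhaustive habitat entry (LU₂)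

`[OURS · L W4.4]` Cell res-hironaka, crux chain W4.4, seat res-L0-w44-stub-1 (gen 8); support-level,
counted 0.  Nothing here is a statement of the manuscript under review (Hironaka 2017); AI-written,
weaker than expert review.  It serves the (V26) entry stub `stub_HabExSw₀` (exhaustive branch) through
res-L0-w44-stub-3's `NoZeno.Sandwiched.exists_isSandwichedGerm_of_exhausts`, whose hypothesis `hLU`
(re-cut 2026-08-27T13:32Z) asks, for a coarsening `W ⊇ O` dominating the thread germs and NOT
essentially of finite type over `k`, for a dominated regular local ess.-f.t. `R` with `dim R = 2`,
`Frac R = K` (the binder itself is produced in the sequel `…CoarseningLUThread`).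

## Content (all sorry-free; the only printed input is the NAMED FACT `CossartJannsenSaito2020`)

* `exists_regular_dominated_of_resolution` — **the ground-field enlargement trick** (Zariski 1939 /
  Abhyankar 1956 folklore): `W ∋ k` a valuation ring of `K = Frac A`, `k₁ ⊆ W` an intermediate field
  of `K/k` lying in the local ring `locAt W k[G]` of a finite `G ⊆ k₁` (e.g. `k₁ = k⟮w⟯`, `G = {w}`),
  `tr.deg_{k₁} K ≤ n`, and resolution of singularities up to dimension `n` over `k₁`
  (`ResolutionOverUpToDim k₁ n`): then `W` DOMINATES a REGULAR LOCAL `k`-subalgebra `R ⊆ K` with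
  `dim R ≤ n`, essentially of finite type over `k`, `Frac R = K`.  (Uniformize `W` on the affine
  `k₁`-model `k₁[A]` by the tree's valuative-criterion bridge `ResolutionOverUpToDim.localUniformization`;
  the local ring `locAt W A'` of the uniformizing `k₁`-model EQUALS `locAt W B` for the finitely
  generated `k`-algebra `B = k[G, generators of A' and A]`, which makes it essentially of finite type
  over `k` — `SyzygyFlattening.stub_essFiniteType_locAt` — and dominated — `subringDominates_locAtCentre`.)
* `exists_regular_dominated_of_residuallyTranscendental` — the case `k₁ = k⟮w⟯` for a RESIDUALLY
  TRANSCENDENTAL `w ∈ W` (`∀ f ≠ 0, ¬ W.valuation (f(w)) < 1`, the binder of the registered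
  `Coarsening.Sig.stub_beta1RankOneSharp`): `k⟮w⟯ ⊆ W` (`adjoin_simple_le`), `k⟮w⟯ ⊆ locAt W k[w]`
  (`adjoin_simple_le_locAt`), `tr.deg_{k⟮w⟯} K ≤ n` if `tr.deg_k K ≤ n + 1` (`trdeg_adjoin_simple_le`,
  additivity of transcendence degree).
* `toSubring_eq_of_ringKrullDim_le_one` — a dominated regular local `R` of dimension `≤ 1` with
  `Frac R = K` IS `W`; hence (`two_le_ringKrullDim_of_not_essFiniteType`) if `W` is not essentially
  of finite type over `k`, a dominated regular ess.-f.t. `R` has `dim R ≥ 2`.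
* **`exists_regular_two_dominated_of_cjs`** — LU₂: `tr.deg_k K ≤ 3`, `w ∈ W` residually
  transcendental, `W` not essentially of finite type ⟹ (mod `CossartJannsenSaito2020`, applied over
  the field `k⟮w⟯`) `W` dominates a regular local ess.-f.t. `R` with `dim R = 2`, `Frac R = K` —
  EXACTLY the output shape of `hLU`.
* The THREAD ADAPTER and the `hLU` binder verbatim (`hLU_of_cjs`) are in the sequel
  `Theorems/HomologicalConductorNoZenoCoarseningLUThread.lean`.

Remark (vacuity of the excluded case, not used): for a DIVISORIAL `W` (essentially of finite type)
the conclusion of `hLU` is false in general — a regular two-dimensional `R` dominated by a prime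
divisor `W` forces `κ(W)` ruled (tree: `RuledResidues.RegularModelRuled`); res-L0-w44-stub-3 shows
that `W = ⋃ D_m` is never essentially of finite type in the exhaustive branch.

References: V. Cossart, U. Jannsen, S. Saito, *Desingularization: invariants and strategy*, LNM 2270
(2020), Thm. 1.2 [`CossartJannsenSaito2020`]; O. Zariski, Ann. of Math. 40 (1939) / S. S. Abhyankar,
Ann. of Math. 63 (1956) (ground-field extension inside the valuation ring; folklore, nothing typed);
J. Novacoski, M. Spivakovsky [`NovacoskiSpivakovsky2014`] Lemma 2.5 (the `locAt` calculus, tree).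
-/

noncomputable section

-- single-problem summit: the doubled namespace component `ResolutionOfSingularities` is forced
set_option linter.dupNamespace false

namespace Summit.ResolutionOfSingularities.ResolutionOfSingularities.Theorems.NoZeno.CoarseningLU

open Literature.AlgebraicGeometry.Resolution IsLocalRing Polynomial IntermediateField
open Summit.ResolutionOfSingularities.ResolutionOfSingularities.Theorems

variable {k K : Type} [Field k] [Field K] [Algebra k K]

/-! ## Residually transcendental elements and the ground field `k⟮w⟯ ⊆ W` -/

/-- A residually transcendental element is transcendental. [folklore] -/
theorem transcendental_of_residuallyTranscendental (W : ValuationSubring K) {w : K}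
    (hwt : ∀ f : k[X], f ≠ 0 → ¬ W.valuation (aeval w f) < 1) : Transcendental k w := by
  intro halg
  obtain ⟨f, hf0, hf⟩ := halg
  exact hwt f hf0 (by rw [hf, map_zero]; exact zero_lt_one)

/-- Non-zero polynomials in a residually transcendental `w ∈ W` are units of `W`. [folklore] -/
theorem valuation_aeval_eq_one (W : ValuationSubring K) {w : K} (hw : w ∈ W)
    (hwt : ∀ f : k[X], f ≠ 0 → ¬ W.valuation (aeval w f) < 1)
    (hk : ∀ c : k, algebraMap k K c ∈ W) {f : k[X]} (hf : f ≠ 0) :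
    W.valuation (aeval w f) = 1 := by
  have hmem : aeval w f ∈ W := by
    have : (Algebra.adjoin k {w}).toSubring ≤ W.toSubring :=
      SyzygyFlattening.adjoin_toSubring_le_valuationSubring W hk (by simpa using hw)
    refine this ?_
    rw [Subalgebra.mem_toSubring, Algebra.adjoin_singleton_eq_range_aeval]
    exact ⟨f, rfl⟩
  exact le_antisymm ((W.valuation_le_one_iff _).mpr hmem) (not_lt.mp (hwt f hf))

/-- **`k⟮w⟯ ⊆ W`** for a residually transcendental `w ∈ W`: every element of `k⟮w⟯` is
`p(w) / q(w)` (`IntermediateField.mem_adjoin_simple_iff`) with `q(w)` zero or a unit of `W`.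
[folklore] -/
theorem adjoin_simple_le (W : ValuationSubring K) {w : K} (hw : w ∈ W)
    (hwt : ∀ f : k[X], f ≠ 0 → ¬ W.valuation (aeval w f) < 1)
    (hk : ∀ c : k, algebraMap k K c ∈ W) {x : K} (hx : x ∈ k⟮w⟯) : x ∈ W := by
  rw [mem_adjoin_simple_iff] at hx
  obtain ⟨p, q, rfl⟩ := hx
  by_cases hq : q = 0
  · simp [hq]
  have hp1 : W.valuation (aeval w p) ≤ 1 := by
    by_cases hp : p = 0
    · simp [hp]
    · exact (valuation_aeval_eq_one W hw hwt hk hp).le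
  rw [← W.valuation_le_one_iff, map_div₀, valuation_aeval_eq_one W hw hwt hk hq, div_one]
  exact hp1

/-- Polynomials in an element of a subalgebra stay in the subalgebra. [folklore] -/
theorem aeval_mem_of_mem (B : Subalgebra k K) {w : K} (hw : w ∈ B) (p : k[X]) : aeval w p ∈ B := by
  have h : Algebra.adjoin k {w} ≤ B := Algebra.adjoin_le (by simpa using hw)
  refine h ?_
  rw [Algebra.adjoin_singleton_eq_range_aeval]
  exact ⟨p, rfl⟩

/-! ## Transcendence degree over `k⟮w⟯` -/

/-- `tr.deg_k k⟮w⟯ ≥ 1` for `w` transcendental. [folklore] -/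
theorem one_le_trdeg_adjoin_simple {w : K} (hw : Transcendental k w) :
    1 ≤ Algebra.trdeg k (k⟮w⟯) := by
  have hw' : Transcendental k (AdjoinSimple.gen k w) := by
    rw [transcendental_iff_injective] at hw ⊢
    intro p q hpq
    apply hw
    have := congrArg (fun z : k⟮w⟯ => (z : K)) hpq
    simpa [AdjoinSimple.algebraMap_gen, aeval_algebraMap_apply] using this
  have h := (algebraicIndependent_iff_transcendental.mpr hw').cardinalMk_le_trdeg
  simpa using h

/-- **`tr.deg_{k⟮w⟯} K ≤ n`** when `tr.deg_k K ≤ n + 1` and `w` is transcendental over `k`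
(additivity of transcendence degree in towers). [folklore] -/
theorem trdeg_adjoin_simple_le {w : K} (hw : Transcendental k w) {n : ℕ}
    (htr : Algebra.trdeg k K ≤ n + 1) : Algebra.trdeg (k⟮w⟯) K ≤ n := by
  have hadd := trdeg_add_eq k (k⟮w⟯) (A := K)
  have h1 := one_le_trdeg_adjoin_simple hw
  -- everything is finite
  have hfin : Algebra.trdeg k K < Cardinal.aleph0 :=
    lt_of_le_of_lt htr (by exact_mod_cast Cardinal.natCast_lt_aleph0)
  rw [← hadd] at hfin htr
  obtain ⟨a, ha⟩ := Cardinal.lt_aleph0.mp (lt_of_le_of_lt (le_self_add) hfin)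
  obtain ⟨b, hb⟩ := Cardinal.lt_aleph0.mp (lt_of_le_of_lt (le_add_self) hfin)
  rw [ha, hb] at htr
  rw [ha] at h1
  rw [hb]
  have h1' : 1 ≤ a := by exact_mod_cast h1
  have htr' : a + b ≤ n + 1 := by exact_mod_cast htr
  have : b ≤ n := by omega
  exact_mod_cast this


/-! ## The uniformizing model over an intermediate field `k₁ ⊆ W` and the regular local ring over `k` -/

/-- **LU WITH SMALL CENTRE over an enlarged ground field, core.** Let `W ∋ k` be a valuation ring
of `K = Frac A` (`A ⊆ W` a finitely generated `k`-algebra) and `k₁ ⊆ W` an intermediate field of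
`K/k` containing a finite set `G` and contained in the local ring `locAt W k[G]` (for `k₁ = k⟮w⟯`:
`G = {w}`), with `tr.deg_{k₁} K ≤ n`.  If resolution of singularities holds up to dimension `n`
over `k₁`, then `W` dominates a REGULAR local `k`-subalgebra `R ⊆ K` of Krull dimension `≤ n`,
essentially of finite type over `k`, with `Frac R = K`.  Proof: uniformize `W` on the affine
`k₁`-model `k₁[A]` (valuative criterion, `ResolutionOverUpToDim.localUniformization`) and localise
at the centre; that local ring is `locAt W B` for the finitely generated `k`-algebra
`B = k[G, generators]`. [folklore] -/
theorem exists_regular_dominated_of_resolution (W : ValuationSubring K)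
    (A : Subalgebra k K) (hA : A.FG)
    (hfr : IsFractionRing ↥A K) (hAW : A.toSubring ≤ W.toSubring)
    (k₁ : IntermediateField k K) (hk₁W : ∀ c : ↥k₁, (c : K) ∈ W) (G : Finset K)
    (hGk₁ : ∀ x ∈ G, x ∈ k₁)
    (hk₁G : ∀ c : ↥k₁, (c : K) ∈ SyzygyFlattening.locAt W (Algebra.adjoin k (G : Set K)))
    {n : ℕ} (htr₁ : Algebra.trdeg (↥k₁) K ≤ n) (hres : ResolutionOverUpToDim (↥k₁) n) :
    ∃ R : Subalgebra k K, IsRegularLocalRing ↥R ∧ ringKrullDim ↥R ≤ n ∧ IsFractionRing ↥R K ∧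
      Algebra.EssFiniteType k ↥R ∧ SubringDominates R.toSubring W.toSubring := by
  classical
  haveI := hfr
  have hk₁W' : ∀ c : ↥k₁, algebraMap (↥k₁) K c ∈ W := hk₁W
  -- the affine `k₁`-model `A₁ = k₁[T] ⊇ A`
  obtain ⟨T, hT⟩ := hA
  have hTA : (T : Set K) ⊆ A := by rw [← hT]; exact Algebra.subset_adjoin
  let A₁ : Subalgebra (↥k₁) K := Algebra.adjoin (↥k₁) (T : Set K)
  have hAA₁' : A ≤ A₁.restrictScalars k := by
    rw [← hT]
    refine Algebra.adjoin_le fun x hx => ?_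
    rw [Subalgebra.coe_restrictScalars]
    exact Algebra.subset_adjoin hx
  have hAA₁ : ∀ x : K, x ∈ A → x ∈ A₁ := fun x hx =>
    (Subalgebra.mem_restrictScalars k).mp (hAA₁' hx)
  have hA₁W : A₁.toSubring ≤ W.toSubring :=
    SyzygyFlattening.adjoin_toSubring_le_valuationSubring W hk₁W' fun x hx => hAW (hTA hx)
  have hA₁fg : A₁.FG := Subalgebra.fg_adjoin_finset _
  have hA₁fr : IsFractionRing ↥A₁ K := by
    refine IsFractionRing.of_field ↥A₁ K fun z => ?_
    obtain ⟨a, b, -, rfl⟩ := IsFractionRing.div_surjective (A := ↥A) z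
    exact ⟨⟨a, hAA₁ a a.2⟩, ⟨b, hAA₁ b b.2⟩, rfl⟩
  have hdimA₁ : ringKrullDim ↥A₁ ≤ n := by
    haveI := hA₁fr
    exact ringKrullDim_le_of_fg_of_trdeg_le A₁ hA₁fg htr₁
  -- uniformize `W` on `A₁`; `R₁ = locAt W A'` is regular local
  obtain ⟨A', hA'W, hA₁A', hA'fg, hreg⟩ := hres.localUniformization K W A₁ hA₁W hA₁fg hA₁fr hdimA₁
  have hR₁reg : IsRegularLocalRing ↥(SyzygyFlattening.locAt W A') :=
    (SyzygyFlattening.isRegularLocalRing_locAt_iff_atPrime W A' hA'W).mpr hreg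
  have hA'R₁ : A' ≤ SyzygyFlattening.locAt W A' := SyzygyFlattening.self_le_locAt W A'
  have hR₁W : (SyzygyFlattening.locAt W A').toSubring ≤ W.toSubring :=
    SyzygyFlattening.locAt_le W A' hA'W
  -- the finitely generated `k`-model `B = k[G, S, T]`, `S` generating `A'` over `k₁`
  obtain ⟨S, hS⟩ := hA'fg
  have hSA' : (S : Set K) ⊆ A' := by rw [← hS]; exact Algebra.subset_adjoin
  let B : Subalgebra k K := Algebra.adjoin k ((G ∪ (S ∪ T) : Finset K) : Set K)
  have hBfg : B.FG := Subalgebra.fg_adjoin_finset _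
  have hGB : Algebra.adjoin k (G : Set K) ≤ B :=
    Algebra.adjoin_mono fun x hx => by
      simp only [Finset.coe_union, Set.mem_union, Finset.mem_coe] at hx ⊢
      exact Or.inl hx
  have hAB : A ≤ B := by
    rw [← hT]
    exact Algebra.adjoin_mono fun x hx => by
      simp only [Finset.coe_union, Set.mem_union, Finset.mem_coe] at hx ⊢
      exact Or.inr (Or.inr hx)
  have hBR₁' : B ≤ (SyzygyFlattening.locAt W A').restrictScalars k := by
    refine Algebra.adjoin_le ?_
    intro x hx
    simp only [Finset.coe_union, Set.mem_union, Finset.mem_coe] at hx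
    rw [SetLike.mem_coe, Subalgebra.mem_restrictScalars]
    rcases hx with hx | hx | hx
    · exact hA'R₁ (A'.algebraMap_mem (⟨x, hGk₁ x hx⟩ : ↥k₁))
    · exact hA'R₁ (hSA' hx)
    · exact hA'R₁ (hA₁A' (Algebra.subset_adjoin hx))
  have hBR₁ : ∀ x : K, x ∈ B → x ∈ SyzygyFlattening.locAt W A' := fun x hx =>
    (Subalgebra.mem_restrictScalars k).mp (hBR₁' hx)
  have hBW : B.toSubring ≤ W.toSubring := fun x hx =>
    hR₁W (Subalgebra.mem_toSubring.mpr (hBR₁ x (Subalgebra.mem_toSubring.mp hx)))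
  -- `R = locAt W B`; first `k₁ ⊆ R`, then `R₁ ⊆ R`, then `R ⊆ R₁`
  have hBR : B ≤ SyzygyFlattening.locAt W B := SyzygyFlattening.self_le_locAt W B
  have hk₁R : ∀ c : ↥k₁, (c : K) ∈ SyzygyFlattening.locAt W B := fun c =>
    SyzygyFlattening.locAt_mono W hGB (hk₁G c)
  have hA'R : ∀ x : K, x ∈ A' → x ∈ SyzygyFlattening.locAt W B := by
    let R' : Subalgebra (↥k₁) K :=
      { carrier := SyzygyFlattening.locAt W B
        mul_mem' := fun ha hb => (SyzygyFlattening.locAt W B).mul_mem ha hb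
        one_mem' := (SyzygyFlattening.locAt W B).one_mem
        add_mem' := fun ha hb => (SyzygyFlattening.locAt W B).add_mem ha hb
        zero_mem' := (SyzygyFlattening.locAt W B).zero_mem
        algebraMap_mem' := hk₁R }
    have h : A' ≤ R' := by
      rw [← hS]
      refine Algebra.adjoin_le fun x hx => ?_
      change x ∈ (SyzygyFlattening.locAt W B : Set K)
      rw [SetLike.mem_coe]
      exact hBR (Algebra.subset_adjoin (by
        simp only [Finset.coe_union, Set.mem_union, Finset.mem_coe]
        exact Or.inr (Or.inl hx)))
    intro x hx
    have hx' : x ∈ (R' : Set K) := h hx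
    exact hx'
  have hR₁R : (SyzygyFlattening.locAt W A').toSubring ≤ (SyzygyFlattening.locAt W B).toSubring := by
    intro y hy
    rw [Subalgebra.mem_toSubring] at hy ⊢
    obtain ⟨a, ha, s, hs, hv, rfl⟩ := (SyzygyFlattening.mem_locAt_iff W A' hA'W).mp hy
    exact (SyzygyFlattening.locAt W B).mul_mem (hA'R a ha)
      (SyzygyFlattening.inv_mem_locAt W B hBW (hA'R s hs) hv)
  have hRR₁ : (SyzygyFlattening.locAt W B).toSubring ≤ (SyzygyFlattening.locAt W A').toSubring := by
    have h : SyzygyFlattening.locAt W B ≤ (SyzygyFlattening.locAt W A').restrictScalars k := by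
      rw [SyzygyFlattening.locAt_def W B]
      refine Algebra.adjoin_le ?_
      rintro _ ⟨a, ha, s, hs, hsW, rfl⟩
      rw [SetLike.mem_coe, Subalgebra.mem_restrictScalars]
      by_cases hs0 : s = 0
      · rw [hs0, inv_zero, mul_zero]; exact (SyzygyFlattening.locAt W A').zero_mem
      exact (SyzygyFlattening.locAt W A').mul_mem (hBR₁ a ha)
        (SyzygyFlattening.inv_mem_locAt W A' hA'W (hBR₁ s hs)
          (SyzygyFlattening.valuation_eq_one_of_inv_mem W
            (hBW (Subalgebra.mem_toSubring.mpr hs)) hsW hs0))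
    intro x hx
    rw [Subalgebra.mem_toSubring] at hx ⊢
    exact (Subalgebra.mem_restrictScalars k).mp (h hx)
  have hRR₁eq : (SyzygyFlattening.locAt W A').toSubring = (SyzygyFlattening.locAt W B).toSubring :=
    le_antisymm hR₁R hRR₁
  -- transport regularity and dimension along `R₁ = R`
  let e : ↥(SyzygyFlattening.locAt W A') ≃+* ↥(SyzygyFlattening.locAt W B) :=
    RingEquiv.subringCongr hRR₁eq
  have hRreg : IsRegularLocalRing ↥(SyzygyFlattening.locAt W B) := by
    haveI := hR₁reg
    exact .of_ringEquiv e
  have hRdim : ringKrullDim ↥(SyzygyFlattening.locAt W B) ≤ n := by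
    rw [← ringKrullDim_eq_of_ringEquiv e]
    refine ringKrullDim_le_of_trdeg_le (k := ↥k₁) ?_
    exact (trdeg_le_of_injective (SyzygyFlattening.locAt W A').val Subtype.val_injective).trans
      htr₁
  have hBfr : IsFractionRing ↥B K := isFractionRing_subalgebra_of_le A B hAB
  have hRfr : IsFractionRing ↥(SyzygyFlattening.locAt W B) K := by
    haveI := hBfr
    exact isFractionRing_subalgebra_of_le B _ hBR
  have hBess : Algebra.EssFiniteType k ↥B := by
    haveI : Algebra.FiniteType k ↥B := B.fg_iff_finiteType.mp hBfg
    infer_instance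
  have hRess : Algebra.EssFiniteType k ↥(SyzygyFlattening.locAt W B) :=
    SyzygyFlattening.stub_essFiniteType_locAt k K W B hBW hBfr hBess
  have hRdom : SubringDominates (SyzygyFlattening.locAt W B).toSubring W.toSubring := by
    rw [SyzygyFlattening.locAt_toSubring_eq_locAtCentre W B hBW]
    exact subringDominates_locAtCentre hBW
  exact ⟨SyzygyFlattening.locAt W B, hRreg, hRdim, hRfr, hRess, hRdom⟩

/-! ## Over `k⟮w⟯` for a residually transcendental `w` -/

/-- `k⟮w⟯ ⊆ locAt W k[w]` for a residually transcendental `w ∈ W`: `p(w)/q(w)` with `q(w)` a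
`W`-unit. [folklore] -/
theorem adjoin_simple_le_locAt (W : ValuationSubring K) {w : K} (hw : w ∈ W)
    (hwt : ∀ f : k[X], f ≠ 0 → ¬ W.valuation (aeval w f) < 1)
    (hk : ∀ c : k, algebraMap k K c ∈ W) (c : ↥k⟮w⟯) :
    (c : K) ∈ SyzygyFlattening.locAt W (Algebra.adjoin k (({w} : Finset K) : Set K)) := by
  have hwB : w ∈ Algebra.adjoin k (({w} : Finset K) : Set K) := Algebra.subset_adjoin (by simp)
  obtain ⟨p, q, hc⟩ := (mem_adjoin_simple_iff (F := k) (α := w) (c : K)).mp c.2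
  rw [hc]
  by_cases hq : q = 0
  · simp only [hq, map_zero, div_zero]; exact Subalgebra.zero_mem _
  rw [div_eq_mul_inv]
  exact SyzygyFlattening.mul_inv_mem_locAt W _ (aeval_mem_of_mem _ hwB p) (aeval_mem_of_mem _ hwB q)
    (inv_mem_of_valuation_eq_one W (valuation_aeval_eq_one W hw hwt hk hq))

/-- **LU WITH SMALL CENTRE from a residually transcendental element.** `W ∋ k` a valuation ring
of `K = Frac A` (`A ⊆ W` finitely generated over `k`), `tr.deg_k K ≤ n + 1`, `w ∈ W` residually
transcendental over `k`, and resolution of singularities up to dimension `n` over `k⟮w⟯`: then `W`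
dominates a regular local `k`-subalgebra `R ⊆ K` of Krull dimension `≤ n`, essentially of finite
type over `k`, with `Frac R = K`. [folklore] -/
theorem exists_regular_dominated_of_residuallyTranscendental (W : ValuationSubring K)
    (hk : ∀ c : k, algebraMap k K c ∈ W) (A : Subalgebra k K) (hA : A.FG)
    (hfr : IsFractionRing ↥A K) (hAW : A.toSubring ≤ W.toSubring)
    {w : K} (hw : w ∈ W) (hwt : ∀ f : k[X], f ≠ 0 → ¬ W.valuation (aeval w f) < 1)
    {n : ℕ} (htr : Algebra.trdeg k K ≤ n + 1) (hres : ResolutionOverUpToDim (↥k⟮w⟯) n) :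
    ∃ R : Subalgebra k K, IsRegularLocalRing ↥R ∧ ringKrullDim ↥R ≤ n ∧ IsFractionRing ↥R K ∧
      Algebra.EssFiniteType k ↥R ∧ SubringDominates R.toSubring W.toSubring :=
  exists_regular_dominated_of_resolution W A hA hfr hAW (k⟮w⟯)
    (fun c => adjoin_simple_le W hw hwt hk c.2) {w}
    (fun x hx => by rw [Finset.mem_singleton] at hx; rw [hx]; exact mem_adjoin_simple_self k w)
    (adjoin_simple_le_locAt W hw hwt hk)
    (trdeg_adjoin_simple_le (transcendental_of_residuallyTranscendental W hwt) htr) hres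

/-! ## Dimension `≤ 1` forces `R = W` essentially of finite type; the two-dimensional conclusion -/

/-- A regular local subalgebra of Krull dimension `≤ 1` with fraction field `K`, dominated by the
valuation ring `W`, IS `W` (it is a field or a discrete valuation ring, hence a valuation ring of
`K` dominated by `W`). [folklore] -/
-- adapted from `RuledResiduesRegularModelRuled.eq_of_isRegularLocalRing_of_ringKrullDim_le_one`
theorem toSubring_eq_of_ringKrullDim_le_one {W : ValuationSubring K} (R : Subalgebra k K)
    (hreg : IsRegularLocalRing ↥R) (hdim : ringKrullDim ↥R ≤ 1) (hfr : IsFractionRing ↥R K)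
    (hdom : SubringDominates R.toSubring W.toSubring) : R.toSubring = W.toSubring := by
  haveI := hreg
  haveI := hfr
  haveI : IsPrincipalIdealRing ↥R := isPrincipalIdealRing_of_ringKrullDim_le_one hdim
  haveI : ValuationRing ↥R :=
    (ValuationRing.iff_local_bezout_domain (R := ↥R)).mpr ⟨inferInstance, inferInstance⟩
  refine le_antisymm hdom.1 fun z hz => ?_
  rcases ValuationRing.isInteger_or_isInteger (↥R) z with ⟨a, ha⟩ | ⟨a, ha⟩
  · rw [← ha]; exact a.2
  · have hinv : z⁻¹ ∈ R.toSubring := by rw [← ha]; exact a.2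
    have h := hdom.2 z⁻¹ hinv (by rw [inv_inv]; exact hz)
    rwa [inv_inv] at h

/-- If a valuation ring `W` is NOT (the subring of) an essentially-finite-type `k`-subalgebra, a
dominated regular local `R` essentially of finite type with `Frac R = K` has Krull dimension
`≥ 2`. [this work] -/
theorem two_le_ringKrullDim_of_not_essFiniteType {W : ValuationSubring K}
    (hness : ¬ ∃ B : Subalgebra k K, B.toSubring = W.toSubring ∧ Algebra.EssFiniteType k ↥B)
    (R : Subalgebra k K) (hreg : IsRegularLocalRing ↥R) (hfr : IsFractionRing ↥R K)
    (hess : Algebra.EssFiniteType k ↥R) (hdom : SubringDominates R.toSubring W.toSubring) :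
    (2 : WithBot ℕ∞) ≤ ringKrullDim ↥R := by
  by_contra h2
  have hsp := hreg.spanFinrank_maximalIdeal
  have h1 : ringKrullDim ↥R ≤ 1 := by
    rw [← hsp] at h2 ⊢
    have : ¬ 2 ≤ (maximalIdeal ↥R).spanFinrank := fun h => h2 (by exact_mod_cast h)
    have : (maximalIdeal ↥R).spanFinrank ≤ 1 := by omega
    exact_mod_cast this
  exact hness ⟨R, toSubring_eq_of_ringKrullDim_le_one R hreg h1 hfr hdom, hess⟩

/-- **LU₂ — LOCAL UNIFORMIZATION WITH TWO-DIMENSIONAL CENTRE of a non-algebraic (non-divisorial)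
valuation ring in transcendence degree three, from `CossartJannsenSaito2020`.**  Let `K = Frac A`
be finitely generated over `k` of transcendence degree `≤ 3`, `W ∋ k` a valuation ring of `K`
containing `A` and a RESIDUALLY TRANSCENDENTAL element `w`, and assume `W` is not essentially of
finite type over `k` (not a prime divisor).  Then, given weak resolution of surfaces over every field
(`CossartJannsenSaito2020`, applied over `k⟮w⟯`), `W` dominates a REGULAR LOCAL `k`-subalgebra
`R ⊆ K` of Krull dimension EXACTLY `2`, essentially of finite type over `k`, with `Frac R = K` —
the shape of the `hLU` input of `NoZeno.Sandwiched.exists_isSandwichedGerm_of_exhausts`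
(res-L0-w44-stub-3). [cite: CossartJannsenSaito2020, Thm. 1.2] -/
theorem exists_regular_two_dominated_of_cjs (hCJS : CossartJannsenSaito2020.{0})
    (W : ValuationSubring K) (hk : ∀ c : k, algebraMap k K c ∈ W) (A : Subalgebra k K)
    (hA : A.FG) (hfr : IsFractionRing ↥A K) (hAW : A.toSubring ≤ W.toSubring)
    (htr : Algebra.trdeg k K ≤ 3) {w : K} (hw : w ∈ W)
    (hwt : ∀ f : k[X], f ≠ 0 → ¬ W.valuation (aeval w f) < 1)
    (hness : ¬ ∃ B : Subalgebra k K, B.toSubring = W.toSubring ∧ Algebra.EssFiniteType k ↥B) :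
    ∃ R : Subalgebra k K, IsRegularLocalRing ↥R ∧ ringKrullDim ↥R = 2 ∧ IsFractionRing ↥R K ∧
      Algebra.EssFiniteType k ↥R ∧ SubringDominates R.toSubring W.toSubring := by
  obtain ⟨R, hreg, hdim, hRfr, hess, hdom⟩ :=
    exists_regular_dominated_of_residuallyTranscendental W hk A hA hfr hAW hw hwt (n := 2)
      (by exact_mod_cast htr) (hCJS _)
  exact ⟨R, hreg, le_antisymm hdim (two_le_ringKrullDim_of_not_essFiniteType hness R hreg hRfr hess
    hdom), hRfr, hess, hdom⟩

end Summit.ResolutionOfSingularities.ResolutionOfSingularities.Theorems.NoZeno.CoarseningLU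

end
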